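import Mathlib
import Summits.ValiantsHypothesis.ValiantsHypothesis.Theorems.LiouvilleSarnakAlignedTypeICharactersMod2nBilinearSieveLambda
import Summits.ValiantsHypothesis.ValiantsHypothesis.Theorems.LiouvilleSarnakAlignedTypeICharactersMod2nBilinearSieveSmallConductor
import HarnessLib

/-!
# Route LiouvilleSarnak — support `AlignedTypeI` (stmt-ValiantsHypothesis-21040), line `characters_mod_2n`:
# only LARGE conductors remain (small conductors discharged by Siegel–Walfisz)

`alignedTypeI_of_vonMangoldtPrimeCharSums` (`…BilinearSieveLambda.lean`) closes the leaf from `ψ(t,χ)`-bounds for ALL primitive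
`χ (mod 2^j)`, `1 ≤ j ≤ k`.  Here the conductors below any threshold `2^J` chosen by the user are discharged with the tree's PROVED
Siegel–Walfisz theorem (`norm_sum_vonMangoldt_char_le_of_siegelWalfisz`), so that only conductors `2^j` with `j ≥ J` remain —
the regime of Banks–Shparlinski 2019, Thm 2.2 (`Literature.NumberTheory.LFunctions.BanksShparlinski2019_theorem22_twoPower_vonMangoldt`):

  H_Λ^large := ∀ θ>0 ∀ η>0 ∃ J k₂ ∀ k ≥ k₂ ∀ j, J ≤ j → j ≤ k → ∀ χ primitive (mod 2^j) ∀ a ≥ θk ∀ t ≥ 2^a: ‖Σ_{n≤t} Λ(n)χ(n)‖ ≤ η t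
  ★ `alignedTypeI_of_largeConductorPrimeCharSums : H_Λ^large → AlignedTypeI` (conditional by arrow, no def).

Remaining to reach «closed modulo the cited BS theorem»: `H_Λ^large` from the named fact = a uniformisation of BS's three ranges
over `t ≥ 2^{θk}`, `j ≥ J` with `J` free to choose (pure real analysis).

HONEST FRAMING. Bookkeeping over landed lemmas; `AlignedTypeI` is NOT closed here; nothing bears on `VP ≠ VNP` (NOT proved).
-/

set_option linter.dupNamespace false

noncomputable section

namespace Summit.ValiantsHypothesis.ValiantsHypothesis.Theorems.LiouvilleSarnak.AlignedTypeI.CharactersModTwoN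

open Finset ArithmeticFunction
open scoped BigOperators

/-- A primitive character to the modulus `2^j`, `j ≥ 1`, is non-principal. [folklore] -/
theorem ne_one_of_isPrimitive_twoPower {j : ℕ} (hj : 1 ≤ j) (χ : DirichletCharacter ℂ (2 ^ j))
    (hχ : χ.IsPrimitive) : χ ≠ 1 := by
  haveI : NeZero (2 ^ j) := ⟨pow_ne_zero _ two_ne_zero⟩
  intro h1
  have hc : χ.conductor = 1 := DirichletCharacter.eq_one_iff_conductor_eq_one.mp h1
  rw [DirichletCharacter.isPrimitive_def] at hχ
  rw [hχ] at hc
  have : 2 ≤ 2 ^ j := by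
    calc 2 = 2 ^ 1 := by norm_num
      _ ≤ 2 ^ j := Nat.pow_le_pow_right (by norm_num) hj
  omega

/-- **Small conductors are free**: `ψ(t,χ)`-bounds for primitive `χ (mod 2^j)` with `j ≥ J` (any `J = J(θ, η)`) imply them for all
`1 ≤ j ≤ k`, the conductors `2^j < 2^J` being covered by Siegel–Walfisz (`q = 2^j ≤ log t` since `log t ≥ θ k log 2`). [folklore] -/
theorem vonMangoldtPrimeCharSums_of_largeConductors
    (h : ∀ th : ℝ, 0 < th → ∀ η : ℝ, 0 < η → ∃ J k₂ : ℕ, ∀ k : ℕ, k₂ ≤ k → ∀ j : ℕ, J ≤ j → j ≤ k →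
      ∀ χ : DirichletCharacter ℂ (2 ^ j), χ.IsPrimitive → ∀ a : ℕ, th * k ≤ a → ∀ t : ℕ, 2 ^ a ≤ t →
        ‖∑ n ∈ Finset.Ioc 0 t, ((vonMangoldt n : ℝ) : ℂ) * χ (n : ZMod (2 ^ j))‖ ≤ η * t) :
    ∀ th : ℝ, 0 < th → ∀ η : ℝ, 0 < η → ∃ k₁ : ℕ, ∀ k : ℕ, k₁ ≤ k → ∀ j : ℕ, 1 ≤ j → j ≤ k →
      ∀ χ : DirichletCharacter ℂ (2 ^ j), χ.IsPrimitive → ∀ a : ℕ, th * k ≤ a → ∀ t : ℕ, 2 ^ a ≤ t →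
        ‖∑ n ∈ Finset.Ioc 0 t, ((vonMangoldt n : ℝ) : ℂ) * χ (n : ZMod (2 ^ j))‖ ≤ η * t := by
  intro th hth η hη
  obtain ⟨J, k₂, hk₂⟩ := h th hth η hη
  obtain ⟨C, hC⟩ := norm_sum_vonMangoldt_char_le_of_siegelWalfisz (A := 1) one_pos
  have hlog2 : 0 < Real.log 2 := Real.log_pos (by norm_num)
  -- `k₃`: makes `log t ≥ th k log 2 ≥ 2^J + |C| 2^J / η`
  obtain ⟨k₃, hk₃⟩ : ∃ k₃ : ℕ, ((2 : ℝ) ^ J + |C| * 2 ^ J / η) / (th * Real.log 2) ≤ k₃ := exists_nat_ge _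
  refine ⟨max k₂ k₃, fun k hk j hj1 hjk χ hχ a ha t ht => ?_⟩
  by_cases hjJ : J ≤ j
  · exact hk₂ k (le_trans (le_max_left _ _) hk) j hjJ hjk χ hχ a ha t ht
  · rw [not_le] at hjJ
    have hk₃k : (k₃ : ℝ) ≤ k := by exact_mod_cast le_trans (le_max_right _ _) hk
    have hbig : (2 : ℝ) ^ J + |C| * 2 ^ J / η ≤ th * k * Real.log 2 := by
      have h1 := (div_le_iff₀ (by positivity)).mp (hk₃.trans hk₃k)
      linarith
    -- `t ≥ 2^a ≥ 2`, `log t ≥ a log 2 ≥ th k log 2`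
    have ha1 : 1 ≤ a := by
      by_contra h0
      have : a = 0 := by omega
      rw [this, Nat.cast_zero] at ha
      have : (0 : ℝ) < th * k := by
        have hk0 : (0 : ℝ) < k := by
          have : (1 : ℝ) ≤ j := by exact_mod_cast hj1
          have : (j : ℝ) ≤ k := by exact_mod_cast hjk
          linarith
        positivity
      linarith
    have htR : (2 : ℝ) ^ a ≤ t := by exact_mod_cast ht
    have ht2 : (2 : ℝ) ≤ t := le_trans (by
      calc (2 : ℝ) = 2 ^ 1 := by norm_num
        _ ≤ 2 ^ a := pow_le_pow_right₀ (by norm_num) ha1) htR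
    have ht0 : (0 : ℝ) < t := by linarith
    have hlogt : th * k * Real.log 2 ≤ Real.log t := by
      have h1 : Real.log ((2 : ℝ) ^ a) ≤ Real.log t := Real.log_le_log (by positivity) htR
      rw [Real.log_pow] at h1
      have h2 : th * k * Real.log 2 ≤ a * Real.log 2 := mul_le_mul_of_nonneg_right ha hlog2.le
      linarith
    have hlogt0 : 0 < Real.log t := Real.log_pos (by linarith)
    have h2j : ((2 ^ j : ℕ) : ℝ) ≤ (2 : ℝ) ^ J := by
      have : 2 ^ j ≤ 2 ^ J := Nat.pow_le_pow_right (by norm_num) hjJ.le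
      exact_mod_cast this
    have hqlog : ((2 ^ j : ℕ) : ℝ) ≤ Real.log t ^ (1 : ℝ) := by
      rw [Real.rpow_one]
      have : |C| * 2 ^ J / η ≥ 0 := by positivity
      linarith
    have hne : χ ≠ 1 := ne_one_of_isPrimitive_twoPower hj1 χ hχ
    have hSW := hC t ht2 (2 ^ j) Nat.one_le_two_pow hqlog χ hne
    rw [Nat.floor_natCast, Real.rpow_one] at hSW
    refine hSW.trans ?_
    -- `C 2^j t / log t ≤ |C| 2^J t / log t ≤ η t`
    have hnum : C * ((2 ^ j : ℕ) : ℝ) * t ≤ |C| * 2 ^ J * t := by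
      have h1 : C * ((2 ^ j : ℕ) : ℝ) ≤ |C| * 2 ^ J :=
        calc C * ((2 ^ j : ℕ) : ℝ) ≤ |C| * ((2 ^ j : ℕ) : ℝ) :=
              mul_le_mul_of_nonneg_right (le_abs_self C) (by positivity)
          _ ≤ |C| * 2 ^ J := mul_le_mul_of_nonneg_left h2j (abs_nonneg C)
      exact mul_le_mul_of_nonneg_right h1 ht0.le
    calc C * ((2 ^ j : ℕ) : ℝ) * t / Real.log t ≤ |C| * 2 ^ J * t / Real.log t :=
          div_le_div_of_nonneg_right hnum hlogt0.le
      _ ≤ η * t := by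
          rw [div_le_iff₀ hlogt0]
          have h1 : |C| * 2 ^ J ≤ η * Real.log t := by
            have h2 : |C| * 2 ^ J / η ≤ Real.log t := by
              have : (0 : ℝ) ≤ 2 ^ J := by positivity
              linarith
            have h3 := (div_le_iff₀ hη).mp h2
            linarith
          have := mul_le_mul_of_nonneg_right h1 ht0.le
          linarith

/-- **`AlignedTypeI` from `ψ(t, χ)`-bounds for primitive characters of LARGE `2`-power conductor** (CONDITIONAL by arrow, no
def; the hypothesis is Banks–Shparlinski 2019 Thm 2.2 uniformised over its three ranges, with the conductor threshold `2^J`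
free): see the module docstring. [folklore] -/
theorem alignedTypeI_of_largeConductorPrimeCharSums
    (h : ∀ th : ℝ, 0 < th → ∀ η : ℝ, 0 < η → ∃ J k₂ : ℕ, ∀ k : ℕ, k₂ ≤ k → ∀ j : ℕ, J ≤ j → j ≤ k →
      ∀ χ : DirichletCharacter ℂ (2 ^ j), χ.IsPrimitive → ∀ a : ℕ, th * k ≤ a → ∀ t : ℕ, 2 ^ a ≤ t →
        ‖∑ n ∈ Finset.Ioc 0 t, ((vonMangoldt n : ℝ) : ℂ) * χ (n : ZMod (2 ^ j))‖ ≤ η * t) :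
    Summit.ValiantsHypothesis.ValiantsHypothesis.Theses.LiouvilleSarnak.AlignedTypeI :=
  alignedTypeI_of_vonMangoldtPrimeCharSums (vonMangoldtPrimeCharSums_of_largeConductors h)

end Summit.ValiantsHypothesis.ValiantsHypothesis.Theorems.LiouvilleSarnak.AlignedTypeI.CharactersModTwoN
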